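import Summits.AnomalousDissipation.AnomalousDissipation.Theorems.SolenoidalFractalHomogenisationLagrangianStepVmodFsPhaseWindow
import HarnessLib

/-!
# K1L_D (stmt-AnomalousDissipation-27980): (V_mod) flat stage, block (fs) — WINDOWS NO LONGER THAN ONE CELL PERIOD, ANY CARRIER PHASE
# (the phase-free replacement of `fs_pairing_le_of_phase_window` (p714354) on `t − s ≤ P = M·W.period/ν`; item (b) «general phase» of D28-5)
(helper; `--supports 27980 --as helper`; prover ad-k1loc-p3 g10.)

For a fast datum `x`, a mean-free slow test `ζ`, and a window `[s,t]` at ANY carrier phase, beyond the fast saturation time and with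
`t − s ≤ M·W.period/ν`, only two per-label leak bounds are needed: the GENERATOR bound `‖𝓕(U v)(ℓ)‖ ≤ (t−s)·A·|ℓ|·‖v‖` (`norm_fc_apply_le_of_fast`,
p713411 — any phase) for slow labels unsaturated under the coarse flow, and the TRIVIAL bound `≤ ‖v‖` for saturated ones.  The generator/allowance
ratio on a window of length `≤ P` is the ν-, n-, ℓ-free constant `η_gen = (3k + π²(hiΛ + β/2))·√(M·W.period·Λ/(c·lo))/(2π)`
(`(t−s)·A² ≤ 4π²·η_gen²·loT` from `A·n ≤ 3k + π²(hiΛ+β/2)`, `loT ≥ (c/ν)(lo/Λ)/n²`, `t − s ≤ M·W.period/ν`).  With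
`abs_inner_sub_le_sqrt_of_fast_modewise` (p713117) and the currency:

  `|⟪U s t x − T s t x, ζ⟫| ≤ ((3k + π²(hiΛ + β/2))·√(M·W.period·Λ/(c·lo))/π + 2√2) · √(lossFwd (T s t) x) · √(lossAdj (T s t) ζ)`

(`fs_pairing_le_of_window_le_period`) — NO phase hypothesis, NO leak lemma.  `sorry`-free; NOT a proof of (fs), of the stub, of K1L_D or of AD;
rung F-D1.A0.
-/

set_option linter.dupNamespace false

noncomputable section

namespace Summit.AnomalousDissipation.AnomalousDissipation.Theorems.SolenoidalFractalHomogenisation.LagrangianStep.VmodFlat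

open Literature.Analysis Literature.Analysis.FluidPDE Literature.Analysis.FunctionSpaces
open MeasureTheory Set Filter UnitAddTorus
open scoped ENNReal NNReal InnerProductSpace
open Summit.AnomalousDissipation.AnomalousDissipation.Theorems.SolenoidalFractalHomogenisation.LagrangianStep.CellClauseMod
open Summit.AnomalousDissipation.AnomalousDissipation.Theorems.SolenoidalFractalHomogenisation.LagrangianStep.LossCurrency
open Summit.AnomalousDissipation.AnomalousDissipation.Theorems.SolenoidalFractalHomogenisation.RealisedQuasiStaticCellLaw
  (isSmooth_cell isDivFree_cell memLp_top_stLift_cell)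

set_option maxHeartbeats 1600000 in
/-- **(fs) ON WINDOWS NO LONGER THAN ONE PERIOD, ANY PHASE.**  See the module docstring. -/
theorem fs_pairing_le_of_window_le_period {k : ℕ} (W : LatticeShear.LatticeWord k) (M : ℝ) (hM : 0 < M) {c : ℝ} (hc : 0 < c)
    (Φ : ℝ → Torus.Visc4 (Fin 3) → Torus.Visc4 (Fin 3)) {lo hi Λ β ν₀ K : ℝ}
    (hlo : 0 < lo) (hhi : 1 ≤ hi) (hΛ : 1 < Λ) (hβ : 0 ≤ β) (hν₀ : ν₀ ≤ 1) (hK : 0 < K)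
    {ν : ℝ} (hν : ν ∈ Set.Ioo 0 ν₀) {n : ℕ} (hn : (⌈K / ν⌉₊ : ℝ) ≤ n) {𝔸 : Torus.Visc4 (Fin 3)}
    (hodd : Torus.OddSmall 𝔸 (ν * β)) (hwin : ∃ lam ∈ Set.Icc (1:ℝ) Λ, Torus.NearIso 𝔸 (ν * (lo / lam)) (ν * (hi * lam)))
    (hΦw : ∃ lam ∈ Set.Icc (1:ℝ) Λ, Torus.NearIso (Φ ν ((1 / ν) • 𝔸)) (lo / lam) (hi * lam))
    {Tw : ℝ} {U T : ℝ → ℝ → (V2 →L[ℝ] V2)}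
    (hU : Torus.IsPropagator Tw (cellField W M hM ν hν.1 n) ((1 / (n:ℝ) ^ 2) • 𝔸) U)
    (hT : Torus.IsPropagator Tw (fun _ _ => 0) ((1 / (n:ℝ) ^ 2) • (𝔸 + (c / ν) • Φ ν ((1 / ν) • 𝔸))) T)
    {s t : ℝ} (hs : 0 ≤ s) (hst : s < t) (htT : t ≤ Tw)
    (hτP : t - s ≤ M * W.period / ν)
    (x ζ : V2) (hx : IsFast n x) (hζ : IsSlowNZ n ζ)
    (hsat : 1 ≤ 8 * Real.pi ^ 2 * loT lo Λ c ν n * ((n / 4 : ℕ) : ℝ) ^ 2 * (t - s)) :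
    |⟪U s t x - T s t x, ζ⟫_ℝ|
      ≤ ((3 * k + Real.pi ^ 2 * (hi * Λ + β / 2)) * Real.sqrt (M * W.period * Λ / (c * lo)) / Real.pi + 2 * Real.sqrt 2)
          * Real.sqrt (lossFwd (T s t) x) * Real.sqrt (lossAdj (T s t) ζ) := by
  classical
  have hn1 : (1:ℝ) ≤ n := by
    have h1 : (1:ℝ) ≤ ⌈K / ν⌉₊ := by
      have : 0 < K / ν := div_pos hK hν.1
      exact_mod_cast Nat.one_le_iff_ne_zero.2 (Nat.pos_iff_ne_zero.1 (Nat.ceil_pos.2 this))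
    exact h1.trans hn
  have hnpos : 0 < n := by exact_mod_cast (show (0:ℝ) < n by linarith)
  have hn0 : (0:ℝ) < n := by exact_mod_cast hnpos
  have hν0 : 0 < ν := hν.1
  have hν1 : ν ≤ 1 := hν.2.le.trans hν₀
  have hΛ0 : 0 < Λ := by linarith
  have hΛ1 : 1 ≤ Λ := hΛ.le
  have hhi0 : 0 ≤ hi := by linarith
  have hts : 0 < t - s := sub_pos.2 hst
  have hsT : s < Tw := lt_of_lt_of_le hst htT
  set N₄ : ℕ := n / 4 with hN₄
  set S : Finset (Fin 3 → ℤ) := (Torus.freqBall (d := Fin 3) (n / 4)).erase 0 with hS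
  have hLN : 2 * (n / 4) < n := by omega
  obtain ⟨lam, hlam, hA𝔸⟩ := hwin
  obtain ⟨lam', hlam', hΦn⟩ := hΦw
  have hlam0 : 0 < lam := by linarith [hlam.1]
  have hlam'0 : 0 < lam' := by linarith [hlam'.1]
  have hcν : 0 ≤ c / ν := div_nonneg hc.le hν0.le
  have hn2 : (0:ℝ) < 1 / (n:ℝ) ^ 2 := by positivity
  have hAΛ : Torus.NearIso 𝔸 (ν * (lo / Λ)) (ν * (hi * Λ)) :=
    hA𝔸.mono (mul_le_mul_of_nonneg_left (div_le_div_of_nonneg_left hlo.le hlam0 hlam.2) hν0.le)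
      (mul_le_mul_of_nonneg_left (mul_le_mul_of_nonneg_left hlam.2 hhi0) hν0.le)
  have hloA : 0 < ν * (lo / Λ) := mul_pos hν0 (div_pos hlo hΛ0)
  have hcell : Torus.NearIso ((1 / (n:ℝ) ^ 2) • 𝔸) ((1 / (n:ℝ) ^ 2) * (ν * (lo / Λ))) ((1 / (n:ℝ) ^ 2) * (ν * (hi * Λ))) := hAΛ.smul hn2.le
  have hcell_lo : 0 < (1 / (n:ℝ) ^ 2) * (ν * (lo / Λ)) := mul_pos hn2 hloA
  have hcoarse0 : Torus.NearIso ((1 / (n:ℝ) ^ 2) • (𝔸 + (c / ν) • Φ ν ((1 / ν) • 𝔸)))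
      ((1 / (n:ℝ) ^ 2) * (ν * (lo / lam) + (c / ν) * (lo / lam'))) ((1 / (n:ℝ) ^ 2) * (ν * (hi * lam) + (c / ν) * (hi * lam'))) :=
    (hA𝔸.add (hΦn.smul hcν)).smul hn2.le
  have hloT_le : loT lo Λ c ν n ≤ (1 / (n:ℝ) ^ 2) * (ν * (lo / lam) + (c / ν) * (lo / lam')) := by
    unfold loT
    have h1 : lo / Λ ≤ lo / lam := div_le_div_of_nonneg_left hlo.le hlam0 hlam.2
    have h2 : lo / Λ ≤ lo / lam' := div_le_div_of_nonneg_left hlo.le hlam'0 hlam'.2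
    have h3 : (ν + c / ν) * (lo / Λ) ≤ ν * (lo / lam) + (c / ν) * (lo / lam') := by
      have := mul_le_mul_of_nonneg_left h1 hν0.le
      have := mul_le_mul_of_nonneg_left h2 hcν
      nlinarith
    exact mul_le_mul_of_nonneg_left h3 hn2.le
  have hloT : 0 < loT lo Λ c ν n := by
    unfold loT
    have hνc : 0 < ν + c / ν := by positivity
    exact mul_pos hn2 (mul_pos hνc (div_pos hlo hΛ0))
  have hcoarse : Torus.NearIso ((1 / (n:ℝ) ^ 2) • (𝔸 + (c / ν) • Φ ν ((1 / ν) • 𝔸)))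
      (loT lo Λ c ν n) ((1 / (n:ℝ) ^ 2) * (ν * (hi * lam) + (c / ν) * (hi * lam'))) := hcoarse0.mono hloT_le le_rfl
  set L : ℝ := loT lo Λ c ν n with hLdef
  have hLc : (c / ν) * (lo / Λ) / (n:ℝ) ^ 2 ≤ L := by
    rw [hLdef]; unfold loT
    rw [div_eq_mul_one_div ((c / ν) * (lo / Λ)) ((n:ℝ) ^ 2), mul_comm ((c / ν) * (lo / Λ))]
    refine mul_le_mul_of_nonneg_left ?_ hn2.le
    have : 0 ≤ ν * (lo / Λ) := by positivity
    nlinarith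
  have hbU : MemLp (Torus.stLift (cellField W M hM ν hν.1 n)) ∞ (volume.restrict (Ioo 0 Tw ×ˢ (univ : Set (EuclideanSpace ℝ (Fin 3))))) :=
    memLp_top_stLift_cell _ n Tw
  have hbUdiv : ∀ᵐ τ ∂(volume.restrict (Ioo (0:ℝ) Tw)), Torus.IsWeaklyDivFree (cellField W M hM ν hν.1 n τ) :=
    ae_of_all _ fun τ => (isDivFree_cell _ n τ).isWeaklyDivFree_holds (isSmooth_cell _ n τ)
  have hgrid : ∀ (j : Fin 3 → Fin n) (τ : ℝ) (y : UnitAddTorus (Fin 3)),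
      cellField W M hM ν hν.1 n τ (y + (fun i => ((((j i : ℕ) : ℝ) / n : ℝ) : UnitAddCircle))) = cellField W M hM ν hν.1 n τ y :=
    fun j τ y => by unfold cellField; exact cell_add_grid _ hnpos j τ y
  have hUcl : ∀ (c' : Fin 3 → ℤ) (y : V2), (∀ k', ((∀ i, (n:ℤ) ∣ k' i - c' i) ∨ (∀ i, (n:ℤ) ∣ k' i + c' i)) →
        mFourierCoeff (EuclideanSpace.complexify ∘ ⇑y) k' = 0) →
      ∀ k', ((∀ i, (n:ℤ) ∣ k' i - c' i) ∨ (∀ i, (n:ℤ) ∣ k' i + c' i)) →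
        mFourierCoeff (EuclideanSpace.complexify ∘ ⇑(U s t y)) k' = 0 :=
    fun c' y hy k' hk' => PropagatorSymm.fcoeff_apply_eq_zero_of_classes hU hcell hcell_lo hbU hbUdiv hnpos hgrid c' hs hst.le htT y hy k' hk'
  have hTmode : ∀ (y : V2) (k' : Fin 3 → ℤ), mFourierCoeff (EuclideanSpace.complexify ∘ ⇑y) k' = 0 →
      mFourierCoeff (EuclideanSpace.complexify ∘ ⇑(T s t y)) k' = 0 :=
    fun y k' hk' => fc_propagator_eq_zero hcoarse hloT (fun _ _ => rfl) hT hs hst.le htT y hk'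
  have halone : ∀ ℓ ∈ S, ∀ k' ∈ S, ((∀ i, (n:ℤ) ∣ k' i - ℓ i) ∨ (∀ i, (n:ℤ) ∣ k' i + ℓ i)) → k' = ℓ ∨ k' = -ℓ :=
    fun ℓ hℓ k' hk' hpair => FlatWindow.alone_of_lt hLN (Finset.mem_of_mem_erase hℓ) (Finset.mem_of_mem_erase hk') hpair
  have hnsc : ∀ ℓ ∈ S, ¬ (∀ i, (n:ℤ) ∣ ℓ i + ℓ i) :=
    fun ℓ hℓ => FlatWindow.not_selfConj_of_lt hLN (Finset.mem_of_mem_erase hℓ) (Finset.ne_of_mem_erase hℓ)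
  have hSneg : ∀ k' ∈ S, -k' ∈ S := fun k' hk' =>
    Finset.mem_erase.2 ⟨neg_ne_zero.2 (Finset.ne_of_mem_erase hk'), Torus.neg_mem_freqBall.2 (Finset.mem_of_mem_erase hk')⟩
  set A : ℝ := 6 * Real.pi * ((k:ℝ) / (2 * Real.pi * (n:ℝ))) +
      4 * Real.pi ^ 2 * ((1 / (n:ℝ) ^ 2) * (ν * (hi * Λ)) + (1 / (n:ℝ) ^ 2) * (ν * β) / 2) * (N₄:ℝ) with hAdef
  have hA0 : 0 ≤ A := by positivity
  set A₁ : ℝ := 3 * k + Real.pi ^ 2 * (hi * Λ + β / 2) with hA₁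
  have hA₁0 : 0 ≤ A₁ := by positivity
  have hWp : 0 < W.period := PermissibleCarrier.period_pos W
  set P : ℝ := M * W.period / ν with hPdef
  have hP0 : 0 < P := by rw [hPdef]; exact div_pos (mul_pos hM hWp) hν0
  set ε : (Fin 3 → ℤ) → ℝ := fun ℓ => min ((t - s) * A * Real.sqrt (Torus.freqNormSq ℓ)) 1 with hεdef
  have hε0 : ∀ ℓ, 0 ≤ ε ℓ := fun ℓ => by rw [hεdef]; exact le_min (by positivity) zero_le_one
  have hleak : ∀ ℓ ∈ S, ∀ v : V2, v ∈ Torus.divFreeL2 (Fin 3) →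
      (∀ k', ¬ ((∀ i, (n:ℤ) ∣ k' i - ℓ i) ∨ (∀ i, (n:ℤ) ∣ k' i + ℓ i)) → mFourierCoeff (EuclideanSpace.complexify ∘ ⇑v) k' = 0) →
      mFourierCoeff (EuclideanSpace.complexify ∘ ⇑v) ℓ = 0 → mFourierCoeff (EuclideanSpace.complexify ∘ ⇑v) (-ℓ) = 0 →
      ‖mFourierCoeff (EuclideanSpace.complexify ∘ ⇑(U s t v)) ℓ‖ ≤ ε ℓ * ‖v‖ := by
    intro ℓ hℓ v _ hvs hv1 hv2
    have hℓball : ℓ ∈ Torus.freqBall (d := Fin 3) (n / 4) := Finset.mem_of_mem_erase hℓ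
    have hvfast : IsFast n v := by
      intro k' hk'
      by_cases hcp : (∀ i, (n:ℤ) ∣ k' i - ℓ i) ∨ (∀ i, (n:ℤ) ∣ k' i + ℓ i)
      · rcases FlatWindow.alone_of_lt hLN hℓball hk' hcp with h | h
        · rw [h]; exact hv1
        · rw [h]; exact hv2
      · exact hvs k' hcp
    have hgen : ‖fc (U s t v) ℓ‖ ≤ (t - s) * A * Real.sqrt (Torus.freqNormSq ℓ) * ‖v‖ :=
      norm_fc_apply_le_of_fast W M hM hlo hhi0 hΛ1 hβ hν.1 hnpos hodd ⟨lam, hlam, hA𝔸⟩ hU hs hst.le htT v hvfast hℓball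
    have htriv : ‖fc (U s t v) ℓ‖ ≤ 1 * ‖v‖ := by
      rw [one_mul]
      have hB := sum_norm_sq_fcoeff_le {ℓ} (U s t v)
      rw [Finset.sum_singleton] at hB
      have h2 : ‖fc (U s t v) ℓ‖ ≤ ‖U s t v‖ := by
        calc ‖fc (U s t v) ℓ‖ = Real.sqrt (‖fc (U s t v) ℓ‖ ^ 2) := (Real.sqrt_sq (norm_nonneg _)).symm
          _ ≤ Real.sqrt (‖U s t v‖ ^ 2) := Real.sqrt_le_sqrt hB
          _ = ‖U s t v‖ := Real.sqrt_sq (norm_nonneg _)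
      exact h2.trans (hU.norm_le s t v)
    show ‖fc (U s t v) ℓ‖ ≤ ε ℓ * ‖v‖
    rw [hεdef]
    simp only
    rw [min_mul_of_nonneg _ _ (norm_nonneg v)]
    exact le_min hgen htriv
  -- the constant: generator part `η_gen = A₁·√(M·W.period·Λ/(c·lo))/(2π)` and the trivial part `√2`
  set ηg : ℝ := A₁ * Real.sqrt (M * W.period * Λ / (c * lo)) / (2 * Real.pi) with hηg
  have hηg0 : 0 ≤ ηg := by positivity
  set η : ℝ := ηg + Real.sqrt 2 with hηdef
  have hη0 : 0 ≤ η := by positivity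
  have hηg_le : ηg ≤ η := by rw [hηdef]; linarith [Real.sqrt_nonneg 2]
  have hη2 : Real.sqrt 2 ≤ η := by rw [hηdef]; linarith
  set d : (Fin 3 → ℤ) → ℝ := fun ℓ => dW lo Λ c ν n (t - s) ℓ with hddef
  have hd0 : ∀ ℓ, 0 ≤ d ℓ := fun ℓ => by
    rw [hddef]; unfold dW
    have : Real.exp (-(8 * Real.pi ^ 2 * loT lo Λ c ν n * Torus.freqNormSq ℓ * (t - s))) ≤ 1 := by
      apply Real.exp_le_one_iff.2
      have := Torus.freqNormSq_nonneg ℓ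
      have : 0 ≤ 8 * Real.pi ^ 2 * loT lo Λ c ν n * Torus.freqNormSq ℓ * (t - s) := by positivity
      linarith
    linarith
  -- `A·n ≤ A₁` (uses `ν ≤ 1`, `N₄ ≤ n/4`)
  have hN4n : (N₄ : ℝ) ≤ (n:ℝ) / 4 := by
    have h4 : 4 * N₄ ≤ n := Nat.mul_div_le n 4
    have : (4:ℝ) * N₄ ≤ n := by exact_mod_cast h4
    linarith
  have hAn : A * n ≤ A₁ := by
    rw [hAdef, hA₁]
    have e1 : (6 * Real.pi * ((k:ℝ) / (2 * Real.pi * (n:ℝ))) +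
        4 * Real.pi ^ 2 * ((1 / (n:ℝ) ^ 2) * (ν * (hi * Λ)) + (1 / (n:ℝ) ^ 2) * (ν * β) / 2) * (N₄:ℝ)) * n
        = 3 * k + 4 * Real.pi ^ 2 * (hi * Λ + β / 2) * ((ν * (N₄:ℝ)) / n) := by
      field_simp
      ring
    rw [e1]
    have h4 : ν * (N₄:ℝ) / n ≤ 1 / 4 := by
      rw [div_le_iff₀ hn0]
      calc ν * (N₄:ℝ) ≤ 1 * (N₄:ℝ) := mul_le_mul_of_nonneg_right hν1 (Nat.cast_nonneg _)
        _ ≤ (n:ℝ) / 4 := by rw [one_mul]; exact hN4n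
        _ = 1 / 4 * n := by ring
    have hq : 0 ≤ 4 * Real.pi ^ 2 * (hi * Λ + β / 2) := by positivity
    nlinarith [mul_le_mul_of_nonneg_left h4 hq]
  -- the key scalar inequality of the generator regime: `(t−s)·A² ≤ 4π²·ηg²·L`
  have hkey : (t - s) * A ^ 2 ≤ 4 * Real.pi ^ 2 * ηg ^ 2 * L := by
    have hAle : A ≤ A₁ / n := by rw [le_div_iff₀ hn0]; exact hAn
    have hA2 : A ^ 2 ≤ (A₁ / n) ^ 2 := pow_le_pow_left₀ hA0 hAle 2
    have h1 : (t - s) * A ^ 2 ≤ P * (A₁ / n) ^ 2 := mul_le_mul hτP hA2 (sq_nonneg _) hP0.le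
    refine h1.trans ?_
    have hηg2 : ηg ^ 2 = A₁ ^ 2 * (M * W.period * Λ / (c * lo)) / (4 * Real.pi ^ 2) := by
      rw [hηg, div_pow, mul_pow, Real.sq_sqrt (by positivity)]
      ring
    rw [hηg2]
    have e2 : 4 * Real.pi ^ 2 * (A₁ ^ 2 * (M * W.period * Λ / (c * lo)) / (4 * Real.pi ^ 2)) * L
        = A₁ ^ 2 * ((M * W.period * Λ / (c * lo)) * L) := by
      field_simp
    rw [e2]
    have e3 : P * (A₁ / n) ^ 2 = A₁ ^ 2 * (P / (n:ℝ) ^ 2) := by rw [div_pow]; ring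
    rw [e3]
    refine mul_le_mul_of_nonneg_left ?_ (sq_nonneg _)
    -- `P/n² ≤ (M·Wp·Λ/(c·lo))·L` from `L ≥ (c/ν)(lo/Λ)/n²`
    have h2 : (M * W.period * Λ / (c * lo)) * ((c / ν) * (lo / Λ) / (n:ℝ) ^ 2) = P / (n:ℝ) ^ 2 := by
      rw [hPdef]; field_simp
    rw [← h2]
    exact mul_le_mul_of_nonneg_left hLc (by positivity)
  have hεd : ∀ ℓ ∈ S, ε ℓ ≤ η * Real.sqrt (d ℓ) := by
    intro ℓ hℓ
    have hf0 : 0 ≤ Torus.freqNormSq ℓ := Torus.freqNormSq_nonneg ℓ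
    set y : ℝ := 8 * Real.pi ^ 2 * L * Torus.freqNormSq ℓ * (t - s) with hy
    have hy0 : 0 ≤ y := by positivity
    have hdy : d ℓ = 1 - Real.exp (-y) := by rw [hddef]; unfold dW; rw [hy]
    by_cases hsat1 : y ≤ 1
    · -- unsaturated: the generator bound against `√(y/2)`
      have hyd : y / 2 ≤ d ℓ := by rw [hdy]; exact Literature.NumberTheory.LFunctions.PrimeReciprocal.half_le_one_sub_exp_neg hy0 hsat1
      have h1 : ε ℓ ≤ (t - s) * A * Real.sqrt (Torus.freqNormSq ℓ) := by rw [hεdef]; exact min_le_left _ _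
      refine h1.trans ?_
      have hsq : ((t - s) * A * Real.sqrt (Torus.freqNormSq ℓ)) ^ 2 ≤ (ηg * Real.sqrt (d ℓ)) ^ 2 := by
        rw [mul_pow, mul_pow, Real.sq_sqrt hf0, mul_pow, Real.sq_sqrt (hd0 ℓ)]
        have h3 : (t - s) ^ 2 * A ^ 2 * Torus.freqNormSq ℓ = (t - s) * ((t - s) * A ^ 2) * Torus.freqNormSq ℓ := by ring
        rw [h3]
        have h4 : (t - s) * ((t - s) * A ^ 2) * Torus.freqNormSq ℓ ≤ (t - s) * (4 * Real.pi ^ 2 * ηg ^ 2 * L) * Torus.freqNormSq ℓ :=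
          mul_le_mul_of_nonneg_right (mul_le_mul_of_nonneg_left hkey hts.le) hf0
        refine h4.trans ?_
        have h5 : (t - s) * (4 * Real.pi ^ 2 * ηg ^ 2 * L) * Torus.freqNormSq ℓ = ηg ^ 2 * (y / 2) := by rw [hy]; ring
        rw [h5]
        exact mul_le_mul_of_nonneg_left hyd (sq_nonneg _)
      have h6 : (t - s) * A * Real.sqrt (Torus.freqNormSq ℓ) ≤ ηg * Real.sqrt (d ℓ) :=
        (pow_le_pow_iff_left₀ (by positivity) (by positivity) two_ne_zero).1 hsq
      exact h6.trans (mul_le_mul_of_nonneg_right hηg_le (Real.sqrt_nonneg _))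
    · -- saturated: the trivial bound
      have hyd : 1 / 2 ≤ d ℓ := by rw [hdy]; exact half_le_one_sub_exp_neg_of_one_le (le_of_lt (not_le.1 hsat1))
      have h1 : ε ℓ ≤ 1 := by rw [hεdef]; exact min_le_right _ _
      refine h1.trans ?_
      have h3 : (1:ℝ) ≤ Real.sqrt 2 * Real.sqrt (1 / 2) := by
        rw [← Real.sqrt_mul (by positivity), show (2:ℝ) * (1 / 2) = 1 by norm_num, Real.sqrt_one]
      exact h3.trans (mul_le_mul hη2 (Real.sqrt_le_sqrt hyd) (Real.sqrt_nonneg _) hη0)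
  have hxS : ∀ k' ∈ S, mFourierCoeff (EuclideanSpace.complexify ∘ ⇑x) k' = 0 := fun k' hk' => hx k' (Finset.mem_of_mem_erase hk')
  have hζS : ∀ k', k' ∉ S → mFourierCoeff (EuclideanSpace.complexify ∘ ⇑ζ) k' = 0 := fun k' hk' => hζ k' hk'
  have key := abs_inner_sub_le_sqrt_of_fast_modewise S (U s t) (T s t) ε hnpos hSneg halone hnsc hε0
    (fun y => hU.apply_eq_apply_starProjection s t y) (fun y => hT.apply_eq_apply_starProjection s t y)
    hUcl hTmode hleak d η hη0 hd0 hεd x ζ hxS hζS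
  have hAζ : ∑ k' ∈ S, d k' * ‖mFourierCoeff (EuclideanSpace.complexify ∘ ⇑ζ) k'‖ ^ 2 ≤ lossAdj (T s t) ζ :=
    sum_weight_le_lossAdj hcoarse hloT hT hs hst.le htT S ζ
  have hFx : (1 / 2) * ‖x‖ ^ 2 ≤ lossFwd (T s t) x := by
    have hsupp : ∀ k', fc x k' ≠ 0 → ((N₄ : ℝ)) ^ 2 ≤ Torus.freqNormSq k' := by
      intro k' hk'
      by_contra hlt
      exact hk' (hx k' (Torus.mem_freqBall.2 (le_of_lt (not_le.1 hlt))))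
    have h := lossFwd_ge_of_supp hcoarse hloT (fun _ _ => rfl) hT hs hst.le htT x (sq_nonneg (N₄ : ℝ)) hsupp
    have he : (1:ℝ) / 2 ≤ 1 - Real.exp (-(8 * Real.pi ^ 2 * L * (N₄:ℝ) ^ 2 * (t - s))) := half_le_one_sub_exp_neg_of_one_le hsat
    exact (mul_le_mul_of_nonneg_right he (sq_nonneg _)).trans h
  have hxle : ‖x‖ ≤ Real.sqrt 2 * Real.sqrt (lossFwd (T s t) x) := by
    rw [← Real.sqrt_mul (by norm_num)]
    calc ‖x‖ = Real.sqrt (‖x‖ ^ 2) := (Real.sqrt_sq (norm_nonneg _)).symm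
      _ ≤ Real.sqrt (2 * lossFwd (T s t) x) := Real.sqrt_le_sqrt (by linarith)
  refine key.trans ?_
  have hs2 : Real.sqrt 2 * Real.sqrt 2 = 2 := Real.mul_self_sqrt (by norm_num)
  have hconst : 2 * η = A₁ * Real.sqrt (M * W.period * Λ / (c * lo)) / Real.pi + 2 * Real.sqrt 2 := by
    rw [hηdef, hηg]; field_simp
  calc Real.sqrt 2 * η * ‖x‖ * Real.sqrt (∑ k' ∈ S, d k' * ‖mFourierCoeff (EuclideanSpace.complexify ∘ ⇑ζ) k'‖ ^ 2)
      ≤ Real.sqrt 2 * η * (Real.sqrt 2 * Real.sqrt (lossFwd (T s t) x)) * Real.sqrt (lossAdj (T s t) ζ) :=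
        mul_le_mul (mul_le_mul_of_nonneg_left hxle (by positivity)) (Real.sqrt_le_sqrt hAζ) (Real.sqrt_nonneg _) (by positivity)
    _ = 2 * η * Real.sqrt (lossFwd (T s t) x) * Real.sqrt (lossAdj (T s t) ζ) := by
        rw [show Real.sqrt 2 * η * (Real.sqrt 2 * Real.sqrt (lossFwd (T s t) x)) = (Real.sqrt 2 * Real.sqrt 2) * η * Real.sqrt (lossFwd (T s t) x) by ring, hs2]
    _ = _ := by rw [hconst]

end Summit.AnomalousDissipation.AnomalousDissipation.Theorems.SolenoidalFractalHomogenisation.LagrangianStep.VmodFlat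

end
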